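import Literature.NumberTheory.Automorphic.ParabolicGLProofs
import Literature.NumberTheory.Automorphic.GLnCongruenceSubgroups
import Literature.NumberTheory.Automorphic.SmoothIndTransport
import Literature.NumberTheory.Automorphic.PAdicRepsJacquetAdmissibilityProofs
import Literature.NumberTheory.Automorphic.ParabolicInductionAdmissibleProofs
import Mathlib.Topology.Algebra.Group.OpenMapping
import HarnessLib

/-!
# Reindexing the standard parabolic data of `GL_n(F)`

Transport data for reducing statements about `i_c σ` for an arbitrary block labelling
`c : n → α` (`n` a finite type, `α` a linear order) to the case of a monotone labelling
`c'' : Fin N → Fin r`. Given an enumeration `e : Fin N ≃ n` and a labelling `c''` inducing the same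
strict preorder on indices (`c'' i < c'' j ↔ c (e i) < c (e j)`):

* the reindexing isomorphism `reindexGL e : GL_N(F) ≃* GL_n(F)` maps `P_{c''}` onto `P_c` and
  `U_{c''}` onto `U_c` (`reindexGL_mem_standardParabolicGL_iff`, `reindexGL_mem_unipotentRadicalGL_iff`);
* `parabolicReindex : P_{c''} →* P_c` (its restriction) and the induced **surjective, continuous and
  open** homomorphism of Levi factors `leviReindexHom : Π_b GL(B''_b) →* Π_a GL(B_a)`
  (`proj_c ∘ reindexGL e ∘ emb_{c''}`; openness by the open mapping theorem for `σ`-compact groups),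
  compatible with the Levi projections (`leviProjection_parabolicReindex`);
* consequence for a representation `σ` of the Levi of `c`: `σ ∘ leviReindexHom` is admissible when
  `σ` is (`IsAdmissible.comp_of_isOpenMap`; irreducibility: `isIrreducible_comp_of_surjective` of
  `ParabolicInductionAdmissibleProofs`);
* local compactness of `GL_m(F)` for any finite index type and of the Levi
  (`locallyCompactSpace_gl'`, `locallyCompactSpace_leviBlocks`).

Definitions `parabolicReindex`, `leviReindexHom`; theorems otherwise; no named facts. [folklore]

## References

* I. N. Bernstein, A. V. Zelevinsky, Ann. Sci. ÉNS 10 (1977), §2.1–2.3 (the functors `i`, `r` only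
  depend on the partition up to the ordering of indices).
-/

noncomputable section

open scoped MatrixGroups Pointwise

namespace Literature.NumberTheory.Automorphic

open Representation

/-! ### Local compactness -/

section LocallyCompact

variable (F : Type*) [Field F] [ValuativeRel F] [TopologicalSpace F] [IsNonarchimedeanLocalField F]

/-- `GL_m(F)` is locally compact for every finite index type `m` (units of the locally compact
ring `M_m(F)`; cf. `instLocallyCompactSpaceStandardParabolicGL` of `ParabolicInduction`). [folklore] -/
theorem locallyCompactSpace_gl' (m : Type*) [Fintype m] [DecidableEq m] : LocallyCompactSpace (GL m F) := by
  haveI := (GaloisRepresentations.IsNonarchimedeanLocalField.isLocalField F).toT2Space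
  haveI : LocallyCompactSpace (Matrix m m F) := inferInstanceAs (LocallyCompactSpace (m → m → F))
  infer_instance

/-- The standard Levi `Π_a GL(B_a, F)` is locally compact, for any finite index type and block
labelling. [folklore] -/
theorem locallyCompactSpace_leviBlocks {n : Type*} [Fintype n] [DecidableEq n] {α : Type*} [Fintype α] [DecidableEq α]
    (c : n → α) : LocallyCompactSpace (Π a, GL {i // c i = a} F) := by
  haveI : ∀ a, LocallyCompactSpace (GL {i // c i = a} F) := fun a => locallyCompactSpace_gl' F _
  infer_instance

end LocallyCompact

/-! ### Comparison of labellings and the reindexing isomorphism -/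

section Reindex

variable (F : Type*) [Field F] {n : Type*} [Fintype n] [DecidableEq n] {α : Type*} [LinearOrder α]
  {N r : ℕ} {c : n → α} {e : Fin N ≃ n} {c'' : Fin N → Fin r}
  (hcc : ∀ i j, c'' i < c'' j ↔ c (e i) < c (e j))

include hcc in
omit [Fintype n] [DecidableEq n] in
/-- Equality of labels corresponds. [folklore] -/
theorem label_eq_iff (i j : Fin N) : c'' i = c'' j ↔ c (e i) = c (e j) := by
  constructor
  · intro h
    rcases lt_trichotomy (c (e i)) (c (e j)) with hlt | heq | hgt
    · exact absurd ((hcc i j).2 hlt) (by rw [h]; exact lt_irrefl _)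
    · exact heq
    · exact absurd ((hcc j i).2 hgt) (by rw [h]; exact lt_irrefl _)
  · intro h
    rcases lt_trichotomy (c'' i) (c'' j) with hlt | heq | hgt
    · exact absurd ((hcc i j).1 hlt) (by rw [h]; exact lt_irrefl _)
    · exact heq
    · exact absurd ((hcc j i).1 hgt) (by rw [h]; exact lt_irrefl _)

include hcc in
omit [Fintype n] [DecidableEq n] in
/-- Weak inequality of labels corresponds. [folklore] -/
theorem label_le_iff (i j : Fin N) : c'' i ≤ c'' j ↔ c (e i) ≤ c (e j) := by
  rw [← not_lt, ← not_lt, hcc]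

include hcc in
/-- **`reindexGL e` maps `P_{c''}` onto `P_c`.** [folklore] -/
theorem reindexGL_mem_standardParabolicGL_iff (g : GL (Fin N) F) :
    reindexGL (k := F) e g ∈ standardParabolicGL F c ↔ g ∈ standardParabolicGL F c'' := by
  simp only [mem_standardParabolicGL_iff, Matrix.BlockTriangular, coe_reindexGL, Matrix.reindex_apply,
    Matrix.submatrix_apply]
  constructor
  · intro h i j hij
    have := @h (e i) (e j) ((hcc j i).1 hij)
    simpa using this
  · intro h i j hij
    exact h ((hcc _ _).2 (by simpa using hij))

include hcc in
/-- **`reindexGL e` maps `U_{c''}` onto `U_c`.** [folklore] -/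
theorem reindexGL_mem_unipotentRadicalGL_iff (g : GL (Fin N) F) :
    reindexGL (k := F) e g ∈ unipotentRadicalGL F c ↔ g ∈ unipotentRadicalGL F c'' := by
  rw [mem_unipotentRadicalGL_iff_apply, mem_unipotentRadicalGL_iff_apply]
  simp only [coe_reindexGL, Matrix.reindex_apply, Matrix.submatrix_apply]
  have hone : ∀ i j : n, (1 : Matrix n n F) i j = (1 : Matrix (Fin N) (Fin N) F) (e.symm i) (e.symm j) := fun i j => by
    by_cases h : i = j
    · subst h; rw [Matrix.one_apply_eq, Matrix.one_apply_eq]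
    · rw [Matrix.one_apply_ne h, Matrix.one_apply_ne (fun h' => h (e.symm.injective h'))]
  constructor
  · intro h i j hij
    have := h (e i) (e j) ((label_le_iff hcc j i).1 hij)
    rw [hone, e.symm_apply_apply, e.symm_apply_apply] at this
    simpa using this
  · intro h i j hij
    rw [hone]
    exact h _ _ ((label_le_iff hcc _ _).2 (by simpa using hij))

variable (c e c'')

/-- **The restriction `P_{c''} → P_c` of the reindexing isomorphism.** [folklore] -/
def parabolicReindex : standardParabolicGL F c'' →* standardParabolicGL F c :=
  ((reindexGL (k := F) e).toMonoidHom.comp (standardParabolicGL F c'').subtype).codRestrict _ fun p =>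
    (reindexGL_mem_standardParabolicGL_iff F hcc _).2 p.2

/-- Unfolding lemma. [folklore] -/
@[simp] theorem coe_parabolicReindex (p : standardParabolicGL F c'') :
    ((parabolicReindex F c e c'' hcc p : standardParabolicGL F c) : GL n F) = reindexGL (k := F) e p := rfl

/-- **The induced homomorphism of Levi factors** `Π_b GL(B''_b) →* Π_a GL(B_a)`:
`m ↦ proj_c (reindexGL e (diag m))`. [folklore] -/
def leviReindexHom : (Π b, GL {i // c'' i = b} F) →* (Π a, GL {i // c i = a} F) :=
  ((leviProjection F c).comp (parabolicReindex F c e c'' hcc)).comp (leviEmbeddingP F c'')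

/-- **Compatibility with the Levi projections**: `proj_c (reindexGL e p) = Θ (proj_{c''} p)` for
`p ∈ P_{c''}` (the unipotent radical `U_{c''}` is mapped into `U_c = ker proj_c`). [folklore] -/
theorem leviProjection_parabolicReindex (p : standardParabolicGL F c'') :
    leviProjection F c (parabolicReindex F c e c'' hcc p) =
      leviReindexHom F c e c'' hcc (leviProjection F c'' p) := by
  -- `p = emb (proj p) * u` with `u ∈ U_{c''}`
  set m := leviEmbeddingP F c'' (leviProjection F c'' p) with hm
  have hu : m⁻¹ * p ∈ unipotentRadicalP F c'' := by
    rw [MonoidHom.mem_ker, map_mul, map_inv, hm, leviProjection_leviEmbeddingP_apply, inv_mul_cancel]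
  have hu' : ((m⁻¹ * p : standardParabolicGL F c'') : GL (Fin N) F) ∈ unipotentRadicalGL F c'' := by
    rw [← unipotentRadicalGL_subgroupOf, Subgroup.mem_subgroupOf] at hu
    exact hu
  have hker : parabolicReindex F c e c'' hcc (m⁻¹ * p) ∈ unipotentRadicalP F c := by
    rw [← unipotentRadicalGL_subgroupOf, Subgroup.mem_subgroupOf, coe_parabolicReindex]
    exact (reindexGL_mem_unipotentRadicalGL_iff F hcc _).2 hu'
  rw [MonoidHom.mem_ker] at hker
  calc leviProjection F c (parabolicReindex F c e c'' hcc p)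
      = leviProjection F c (parabolicReindex F c e c'' hcc (m * (m⁻¹ * p))) := by rw [mul_inv_cancel_left]
    _ = leviProjection F c (parabolicReindex F c e c'' hcc m) := by rw [map_mul, map_mul, hker, mul_one]
    _ = leviReindexHom F c e c'' hcc (leviProjection F c'' p) := rfl

/-- `leviReindexHom` is surjective: `m = Θ (proj_{c''} (reindexGL e⁻¹ (emb_c m)))`. [folklore] -/
theorem leviReindexHom_surjective [Fintype α] : Function.Surjective (leviReindexHom F c e c'' hcc) := by
  intro m
  have hmem : (reindexGL (k := F) e).symm (leviEmbeddingP F c m : GL n F) ∈ standardParabolicGL F c'' := by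
    rw [← reindexGL_mem_standardParabolicGL_iff F hcc, MulEquiv.apply_symm_apply]
    exact (leviEmbeddingP F c m).2
  refine ⟨leviProjection F c'' ⟨_, hmem⟩, ?_⟩
  rw [← leviProjection_parabolicReindex]
  have : parabolicReindex F c e c'' hcc ⟨_, hmem⟩ = leviEmbeddingP F c m := by
    apply Subtype.ext
    rw [coe_parabolicReindex]
    exact MulEquiv.apply_symm_apply _ _
  rw [this, leviProjection_leviEmbeddingP_apply]

/-! ### Topology: continuity and openness of `leviReindexHom` -/

section Topology

variable [ValuativeRel F] [TopologicalSpace F] [IsNonarchimedeanLocalField F]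

omit hcc in
/-- Continuity of the Levi projection (private copy of `continuous_leviProjection` of
`ParabolicSemidirect`, not imported because of its adelic dependencies). [folklore] -/
private theorem continuous_leviProjection₅ {m : Type*} [Fintype m] [DecidableEq m] {β : Type*} [LinearOrder β]
    (d : m → β) : Continuous (leviProjection F d) := by
  haveI : IsTopologicalRing F := inferInstance
  refine continuous_pi fun a => Units.continuous_iff.2 ⟨?_, ?_⟩
  · exact continuous_matrix fun i j =>
      (Units.continuous_val.comp continuous_subtype_val).matrix_elem (i : m) (j : m)
  · exact continuous_matrix fun i j =>
      ((Units.continuous_val.comp continuous_subtype_val).comp continuous_inv).matrix_elem (i : m) (j : m)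

omit hcc in
/-- Continuity of the block diagonal embedding into `P_c` (private copy of
`continuous_blockDiagonalGL` of `ParabolicSemidirect`, as above). [folklore] -/
private theorem continuous_leviEmbeddingP₅ {m : Type*} [Fintype m] [DecidableEq m] {β : Type*} [LinearOrder β]
    [Fintype β] (d : m → β) : Continuous (leviEmbeddingP F d) := by
  haveI : IsTopologicalRing F := inferInstance
  have hval : Continuous fun x : (Π a, GL {i // d i = a} F) => ((blockDiagonalGL F d x : GL m F) : Matrix m m F) := by
    have h : Continuous fun x : (Π a, GL {i // d i = a} F) => fun a =>
        ((x a : GL {i // d i = a} F) : Matrix {i // d i = a} {i // d i = a} F) :=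
      continuous_pi fun a => Units.continuous_val.comp (continuous_apply a)
    refine continuous_matrix fun i j => ?_
    simp_rw [blockDiagonalGL_apply_coe]
    exact h.matrix_blockDiagonal'.matrix_elem _ _
  have hbd : Continuous (blockDiagonalGL F d) := by
    refine Units.continuous_iff.2 ⟨hval, ?_⟩
    have : (fun x : (Π a, GL {i // d i = a} F) => (((blockDiagonalGL F d x)⁻¹ : GL m F) : Matrix m m F)) =
        fun x => ((blockDiagonalGL F d x⁻¹ : GL m F) : Matrix m m F) := by
      funext x; rw [map_inv]
    rw [this]
    exact hval.comp continuous_inv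
  exact hbd.subtype_mk _

omit [ValuativeRel F] [IsNonarchimedeanLocalField F] in
/-- `parabolicReindex` is continuous. [folklore] -/
theorem continuous_parabolicReindex : Continuous (parabolicReindex F c e c'' hcc) := by
  have hφ : Continuous (reindexGL (k := F) e) :=
    Units.continuous_map (f := (Matrix.reindexAlgEquiv F F e).toMulEquiv.toMonoidHom) (continuous_id.matrix_reindex e e)
  exact (hφ.comp continuous_subtype_val).subtype_mk _

/-- `leviReindexHom` is continuous. [folklore] -/
theorem continuous_leviReindexHom : Continuous (leviReindexHom F c e c'' hcc) :=
  ((continuous_leviProjection₅ F c).comp (continuous_parabolicReindex F c e c'' hcc)).comp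
    (continuous_leviEmbeddingP₅ F c'')

/-- **`leviReindexHom` is an open map** (open mapping theorem for the surjective continuous
homomorphism from the `σ`-compact group `Π_b GL(B''_b)` onto the locally compact Hausdorff group
`Π_a GL(B_a)`). [folklore] -/
theorem isOpenMap_leviReindexHom [Fintype α] : IsOpenMap (leviReindexHom F c e c'' hcc) := by
  haveI : IsTopologicalRing F := inferInstance
  haveI := (GaloisRepresentations.IsNonarchimedeanLocalField.isLocalField F).toT2Space
  haveI := sigmaCompactSpace_levi F c''
  haveI := locallyCompactSpace_leviBlocks F c
  exact MonoidHom.isOpenMap_of_sigmaCompact _ (leviReindexHom_surjective F c e c'' hcc)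
    (continuous_leviReindexHom F c e c'' hcc)

end Topology

end Reindex

/-! ### Representations composed with a surjective (open) homomorphism -/

section Comp

variable {k L L' V : Type*} [Field k] [Group L] [Group L'] [AddCommGroup V] [Module k V]
  (ρ : Representation k L V) (Θ : L' →* L)

-- irreducibility of `ρ ∘ Θ` for `Θ` surjective: `isIrreducible_comp_of_surjective`
-- (`ParabolicInductionAdmissibleProofs`).

variable [TopologicalSpace L] [TopologicalSpace L'] (hΘc : Continuous Θ) (hΘo : IsOpenMap Θ)

include hΘc in
/-- Composing with a continuous homomorphism preserves smoothness. [folklore] -/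
theorem IsSmooth.comp_of_continuous (hρ : ρ.IsSmooth) : IsSmooth (ρ.comp Θ) := fun v =>
  (hρ v).preimage hΘc

include hΘc hΘo in
/-- **Composing with a continuous open homomorphism preserves admissibility**: the vectors fixed
by a compact open `K' ≤ L'` under `ρ ∘ Θ` are the vectors fixed by the compact open subgroup
`Θ(K')` under `ρ`. [folklore] -/
theorem IsAdmissible.comp_of_isOpenMap (hρ : ρ.IsAdmissible) : IsAdmissible (ρ.comp Θ) := by
  refine ⟨IsSmooth.comp_of_continuous ρ Θ hΘc hρ.isSmooth, fun K hK => ?_⟩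
  let K₁ : Subgroup L := (K : Subgroup L').map Θ
  have hK₁o : IsOpen (K₁ : Set L) := hΘo _ K.isOpen
  have hK₁c : IsCompact (K₁ : Set L) := hK.image hΘc
  haveI : Module.Finite k (ρ.fixedPoints K₁) := hρ.2 ⟨K₁, hK₁o⟩ hK₁c
  have heq : Representation.fixedPoints (ρ.comp Θ) (K : Subgroup L') = ρ.fixedPoints K₁ := by
    ext v
    simp only [mem_fixedPoints]
    constructor
    · rintro hv _ ⟨g', hg', rfl⟩
      exact hv g' hg'
    · intro hv g' hg'
      exact hv (Θ g') ⟨g', hg', rfl⟩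
  rw [heq]
  infer_instance

end Comp

/-! ### Transport of `i_c σ` along the reindexing -/

section Transport

variable (F : Type*) [Field F] [ValuativeRel F] [TopologicalSpace F] [IsNonarchimedeanLocalField F]
  {n : Type*} [Fintype n] [DecidableEq n] {α : Type*} [LinearOrder α]
  {N r : ℕ} (c : n → α) (e : Fin N ≃ n) (c'' : Fin N → Fin r) (hcc : ∀ i j, c'' i < c'' j ↔ c (e i) < c (e j))

/-- **`i_c σ` and `i_{c''} (σ ∘ Θ)` have the same length.** Along the reindexing isomorphism
`reindexGL e : GL_N(F) ≃* GL_n(F)` (mapping `P_{c''}` onto `P_c`, with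
`δ_{P_{c''}}^{1/2} = δ_{P_c}^{1/2} ∘ reindexGL e` and `proj_c ∘ reindexGL e = Θ ∘ proj_{c''}`), the map
`f ↦ f ∘ (reindexGL e)⁻¹` is an equivariant linear isomorphism `i_{c''}(σ ∘ Θ) ≃ i_c σ`
(`SmoothInd.transportEquiv`), so the lattices of subrepresentations agree. [folklore] -/
theorem isFiniteLength_parabolicIndGL_iff_reindex {W : Type*} [AddCommGroup W] [Module ℂ W]
    (ω : Representation ℂ (Π a, GL {i // c i = a} F) W) :
    IsFiniteLength (MonoidAlgebra ℂ (GL (Fin N) F))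
        (parabolicIndGL F c'' (ω.comp (leviReindexHom F c e c'' hcc))).asModule ↔
      IsFiniteLength (MonoidAlgebra ℂ (GL n F)) (parabolicIndGL F c ω).asModule := by
  haveI : IsTopologicalRing F := inferInstance
  -- the reindexing isomorphism and its continuity
  have hφ : Continuous (reindexGL (k := F) e) :=
    Units.continuous_map (f := (Matrix.reindexAlgEquiv F F e).toMulEquiv.toMonoidHom) (continuous_id.matrix_reindex e e)
  have hφ' : Continuous (reindexGL (k := F) e).symm :=
    Units.continuous_map (f := (Matrix.reindexAlgEquiv F F e.symm).toMulEquiv.toMonoidHom)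
      (continuous_id.matrix_reindex e.symm e.symm)
  have hH : ∀ x, reindexGL (k := F) e x ∈ standardParabolicGL F c ↔ x ∈ standardParabolicGL F c'' :=
    reindexGL_mem_standardParabolicGL_iff F hcc
  -- compatibility of the inducing data
  have hσ : ∀ x : standardParabolicGL F c'',
      Representation.twist (((ω.comp (leviReindexHom F c e c'' hcc)).comp (leviProjection F c'')))
          (rootDeltaChar (standardParabolicGL F c'')) x =
        Representation.twist (ω.comp (leviProjection F c)) (rootDeltaChar (standardParabolicGL F c))
          ⟨reindexGL (k := F) e x, (hH x).2 x.2⟩ := by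
    intro x
    refine LinearMap.ext fun v => ?_
    change ((rootDeltaChar (standardParabolicGL F c'') x : ℂˣ) : ℂ) •
        ω (leviReindexHom F c e c'' hcc (leviProjection F c'' x)) v =
      ((rootDeltaChar (standardParabolicGL F c) ⟨reindexGL (k := F) e x, (hH x).2 x.2⟩ : ℂˣ) : ℂ) •
        ω (leviProjection F c ⟨reindexGL (k := F) e x, (hH x).2 x.2⟩) v
    rw [rootDeltaChar_transport (reindexGL (k := F) e) hφ hφ' hH x, ← leviProjection_parabolicReindex F c e c'' hcc x]
    rfl
  exact isFiniteLength_iff_of_equivariant_equiv (reindexGL (k := F) e)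
    (SmoothInd.transportEquiv (reindexGL (k := F) e) hφ hφ' hH hσ)
    (SmoothInd.transportEquiv_smoothIndRep (reindexGL (k := F) e) hφ hφ' hH hσ)

omit [ValuativeRel F] [TopologicalSpace F] [IsNonarchimedeanLocalField F] [DecidableEq n] in
/-- **Existence of a monotone relabelling**: every block labelling `c : n → α` of a finite type is,
along some enumeration `e : Fin N ≃ n`, order-equivalent to a monotone labelling
`c'' : Fin N → Fin r` (`c'' i < c'' j ↔ c (e i) < c (e j)`). [folklore] -/
theorem exists_monotone_relabelling (c : n → α) :
    ∃ (N r : ℕ) (e : Fin N ≃ n) (c'' : Fin N → Fin r),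
      Monotone c'' ∧ ∀ i j, c'' i < c'' j ↔ c (e i) < c (e j) := by
  classical
  obtain ⟨N, e, hmono⟩ : ∃ (N : ℕ) (e : Fin N ≃ n), Monotone (c ∘ e) :=
    ⟨Fintype.card n, (Tuple.sort (c ∘ (Fintype.equivFin n).symm)).trans (Fintype.equivFin n).symm,
      Tuple.monotone_sort (c ∘ (Fintype.equivFin n).symm)⟩
  let S : Finset α := Finset.univ.image (c ∘ e)
  let ι : Fin S.card ≃o (S : Set α) := S.orderIsoOfFin rfl
  have hmem : ∀ i, c (e i) ∈ S := fun i => Finset.mem_image.2 ⟨i, Finset.mem_univ _, rfl⟩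
  let c'' : Fin N → Fin S.card := fun i => ι.symm ⟨c (e i), hmem i⟩
  have hcc : ∀ i j, c'' i < c'' j ↔ c (e i) < c (e j) := fun i j => by
    change ι.symm _ < ι.symm _ ↔ _
    rw [OrderIso.lt_iff_lt]
    rfl
  refine ⟨N, S.card, e, c'', fun i j hij => ?_, hcc⟩
  rw [← not_lt, hcc, not_lt]
  exact hmono hij

end Transport

end Literature.NumberTheory.Automorphic
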